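import Summits.BirchSwinnertonDyer.BirchSwinnertonDyer.Theorems.ManinLocalTwoThreeDefs
import Summits.BirchSwinnertonDyer.BirchSwinnertonDyer.Theorems.ManinLocalTwoThreeCuspClasses
import Summits.BirchSwinnertonDyer.BirchSwinnertonDyer.Theorems.ManinLocalTwoThreeHeckeNeighbours
import HarnessLib

/-!
# `T_r = ρ_r + r ρ_r⁻¹` on `Γ₀(M)`-invariant functions of cusps

Summit `BirchSwinnertonDyer`, route `ManinLocalTwoThree` (cell bsd-f2-manin), cruxes C2 `ManinOddAtFour`
(stmt-BirchSwinnertonDyer-22967) / C3 `ManinPrimeToThreeAtNine` (stmt-BirchSwinnertonDyer-22968).  Fourth file of the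
cusp-symbol layer (MEMO-es §22–§23) toward E-es-30 `BoundaryEisenstein` («the cusp module of `Γ₀(M)` is Eisenstein»).
For a prime `r ∤ M`, a `Γ₀(M)`-invariant function `w` on `P¹(ℚ) = OnePoint ℚ` and a cusp `x`:

  `(T_r w)(x) = w(ρ_r x) + r · w(ρ_r⁻¹ x)`        (`cuspFunHecke_eq_heckeNbr`)

where `T_r = cuspFunHecke M r K` (`Theorems/ManinLocalTwoThreeDefs.lean`: `Σᵢ w(β̃ᵢ x)` over the tree's Hecke
representatives), `ρ_r x = heckeNbrInfty hr x` is the neighbour `βᵢ x` with `σ(i) = ∞` and `ρ_r⁻¹ x = heckeNbrZero hr x` a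
neighbour with `σ(i) ≠ ∞` (Shimura (8.3.2) permutation data at level `1`).  Ingredients: the `GL₂(ℚ)` form of
`βᵢ g = g'ᵢ β_{σ(i)}` (`heckeRepGL_mul_mapGL`), so `βᵢ (g∞) = g'ᵢ ∞`; the bottom-row classes of the `g'ᵢ`
(`Theorems/ManinLocalTwoThreeHeckeNeighbours.lean`: `(c, r d)` once, `(r c, d)` `r` times); and the orbit criterion
(`Theorems/ManinLocalTwoThreeCuspClasses.lean`).  Also: the classes of `ρ_r x`, `ρ_r⁻¹ x` relative to ANY matrix `g` with
`g∞ = x` (`heckeNbrInfty_class`, `heckeNbrZero_class`), from which the next file derives that `ρ_r`, `ρ_r⁻¹` are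
well defined on `Γ₀(M)`-orbits, mutually inverse, commuting, and depend on `r mod M` only — i.e. an action of
`(ℤ/M)^×` — whence the Eisenstein systems `χ(r) + r χ⁻¹(r)`.

No new definitions; nothing about BSD or Manin's conjecture is proved here.

References: G. Shimura, *Introduction to the arithmetic theory of automorphic functions* (1971) §8.3 (8.3.2); F. Diamond,
J. Shurman, GTM 228, §5.2 and Prop. 3.8.3; cell memo HOME/MEMO-es.md §22.3 («`T_r = σ_r + r σ_r⁻¹`»).
-/

set_option autoImplicit false
set_option linter.dupNamespace false

open scoped MatrixGroups

open CongruenceSubgroup Matrix.SpecialLinearGroup Literature.NumberTheory.EllipticCurves.ModularForms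

namespace Summit.BirchSwinnertonDyer.BirchSwinnertonDyer.Theorems.ManinLocalTwoThree

/-! ### The permutation identity in `GL₂(ℚ)` and on points -/

section GLForm

variable {N r : ℕ} [NeZero r] (hr : r.Prime)

/-- The matrix of `mapGL ℚ g` is the rational image of the integer matrix of `g`. [folklore] -/
theorem coe_mapGL_rat (g : SL(2, ℤ)) :
    ((mapGL ℚ g : GL (Fin 2) ℚ) : Matrix (Fin 2) (Fin 2) ℚ) = (g : Matrix (Fin 2) (Fin 2) ℤ).map (Int.castRingHom ℚ) := by
  ext i j
  simp [Matrix.SpecialLinearGroup.mapGL_coe_matrix]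

/-- **`β̃ᵢ g = g'ᵢ β̃_{σ(i)}` in `GL₂(ℚ)`** — the tree's `heckePermElt_spec` (integer matrices) transported to
Mathlib's `GL (Fin 2) ℚ`. [cite: Shimura1971, §8.3 p. 237] -/
theorem heckeRepGL_mul_mapGL (g : Gamma0 N) (i : HeckeIdx N r) :
    heckeRepGL r i.1 * (mapGL ℚ (g : SL(2, ℤ)) : GL (Fin 2) ℚ) =
      (mapGL ℚ ((heckePermElt hr g i : Gamma0 N) : SL(2, ℤ)) : GL (Fin 2) ℚ) * heckeRepGL r (heckePerm hr g i).1 := by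
  apply Units.ext
  rw [Units.val_mul, Units.val_mul, coe_heckeRepGL, coe_heckeRepGL, coe_mapGL_rat, coe_mapGL_rat,
    ← Matrix.map_mul, ← Matrix.map_mul, heckePermElt_spec hr g i]

/-- **`βᵢ (g ∞) = g'ᵢ ∞`**: the `i`-th Hecke translate of the cusp `g∞` is the cusp of `g'ᵢ` (`β̃_{σ(i)}` fixes `∞`).
[cite: Shimura1971, §8.3 (8.3.2)] -/
theorem heckeRepGL_smul_mapGL_smul_infty (g : Gamma0 N) (i : HeckeIdx N r) :
    heckeRepGL r i.1 • (mapGL ℚ (g : SL(2, ℤ)) : GL (Fin 2) ℚ) • (OnePoint.infty : OnePoint ℚ) =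
      (mapGL ℚ ((heckePermElt hr g i : Gamma0 N) : SL(2, ℤ)) : GL (Fin 2) ℚ) • OnePoint.infty := by
  rw [← mul_smul, heckeRepGL_mul_mapGL hr, mul_smul, heckeRepGL_smul_infty]

end GLForm

/-! ### Units mod `M` and primitivity (plumbing) -/

section Units

/-- A prime `r ∤ M` is a unit mod `M`: `s r + t M = 1`. [folklore] -/
theorem exists_unit_of_prime_not_dvd {r M : ℕ} (hr : r.Prime) (hM : ¬ r ∣ M) : ∃ s t : ℤ, s * r + t * M = 1 := by
  obtain ⟨s, t, hst⟩ := Nat.isCoprime_iff_coprime.mpr ((Nat.Prime.coprime_iff_not_dvd hr).mpr hM)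
  exact ⟨s, t, by linear_combination hst⟩

/-- Primitivity of `(r c, r d)` mod `M` from `a d − b c = 1` and `r` a unit mod `M`. [folklore] -/
theorem primitive_scale {M a b c d r s t : ℤ} (hdet : a * d - b * c = 1) (hr : s * r + t * M = 1) :
    ∃ α β μ : ℤ, α * (r * c) + β * (r * d) + μ * M = 1 :=
  ⟨-(b * s), a * s, t, by linear_combination (s * r) * hdet + hr⟩

end Units

/-! ### The classes of the two distinguished neighbours -/

section Classes

variable {r : ℕ} [NeZero r] (hr : r.Prime) (M : ℕ)

/-- **Class of `ρ_r x`**: for ANY `g ∈ SL₂(ℤ)` with `g∞ = x` and any `M` with `r ∤ M`, `ρ_r x = P∞` for a matrix `P` whose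
bottom row lies in the class of `(c, r d)`, `(c, d)` the bottom row of `g`. [cite: Shimura1971, §8.3 (8.3.2)] -/
theorem heckeNbrInfty_class (hM : ¬ r ∣ M) (g : SL(2, ℤ)) (x : OnePoint ℚ)
    (hx : (mapGL ℚ g : GL (Fin 2) ℚ) • (OnePoint.infty : OnePoint ℚ) = x) :
    ∃ P : SL(2, ℤ), heckeNbrInfty hr x = (mapGL ℚ P : GL (Fin 2) ℚ) • (OnePoint.infty : OnePoint ℚ) ∧
      ∃ k : ℤ, (M : ℤ) ∣ P 1 0 * (r * g 1 1 + k * g 1 0) - P 1 1 * g 1 0 := by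
  obtain ⟨s, t, hst⟩ := exists_unit_of_prime_not_dvd hr hM
  refine ⟨(heckePermElt hr (cuspMatrix₁ x) (heckeIdxPre hr (cuspMatrix₁ x) none) : Gamma0 1), rfl, ?_⟩
  -- `g ~ h := cuspMatrix x`, then `(c, r d) ~ (c_h, r d_h) ~ bottom P`
  have hgh : ∃ k : ℤ, (M : ℤ) ∣ (cuspMatrix x) 1 0 * (g 1 1 + k * g 1 0) - (cuspMatrix x) 1 1 * g 1 0 :=
    cuspRel_of_smul_infty_eq M g (cuspMatrix x) (by rw [hx, cuspMatrix_smul_infty])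
  have h1 := cuspRel_mul_right (M : ℤ) (r : ℤ) hgh
  have h2 := cuspRel_heckePermElt_of_none hr (cuspMatrix₁ x) (heckeIdxPre hr (cuspMatrix₁ x) none) (M : ℤ)
    (heckePerm_heckeIdxPre hr _ none)
  rw [coe_cuspMatrix₁] at h2
  exact cuspRel_trans (M : ℤ) (primitive_mul_right (M : ℤ) (det_entries (cuspMatrix x)) hst) h1 h2

/-- **Class of `ρ_r⁻¹ x`**: for ANY `g ∈ SL₂(ℤ)` with `g∞ = x` and any `M` with `r ∤ M`, `ρ_r⁻¹ x = Q∞` for a matrix `Q`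
whose bottom row lies in the class of `(r c, d)`. [cite: Shimura1971, §8.3 (8.3.2)] -/
theorem heckeNbrZero_class (hM : ¬ r ∣ M) (g : SL(2, ℤ)) (x : OnePoint ℚ)
    (hx : (mapGL ℚ g : GL (Fin 2) ℚ) • (OnePoint.infty : OnePoint ℚ) = x) :
    ∃ Q : SL(2, ℤ), heckeNbrZero hr x = (mapGL ℚ Q : GL (Fin 2) ℚ) • (OnePoint.infty : OnePoint ℚ) ∧
      ∃ k : ℤ, (M : ℤ) ∣ Q 1 0 * (g 1 1 + k * (r * g 1 0)) - Q 1 1 * (r * g 1 0) := by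
  obtain ⟨s, t, hst⟩ := exists_unit_of_prime_not_dvd hr hM
  refine ⟨(heckePermElt hr (cuspMatrix₁ x) (heckeIdxPre hr (cuspMatrix₁ x) (some 0)) : Gamma0 1), rfl, ?_⟩
  have hgh : ∃ k : ℤ, (M : ℤ) ∣ (cuspMatrix x) 1 0 * (g 1 1 + k * g 1 0) - (cuspMatrix x) 1 1 * g 1 0 :=
    cuspRel_of_smul_infty_eq M g (cuspMatrix x) (by rw [hx, cuspMatrix_smul_infty])
  have h1 := cuspRel_mul_left (M : ℤ) hst hgh
  have h2 := cuspRel_heckePermElt_of_some hr (cuspMatrix₁ x) (heckeIdxPre hr (cuspMatrix₁ x) (some 0)) hst 0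
    (heckePerm_heckeIdxPre hr _ (some 0))
  rw [coe_cuspMatrix₁] at h2
  exact cuspRel_trans (M : ℤ) (primitive_mul_left (M : ℤ) (det_entries (cuspMatrix x)) hst) h1 h2

end Classes

/-! ### The Hecke sum -/

section HeckeSum

variable {r : ℕ} [NeZero r] (hr : r.Prime) (M : ℕ)

include hr in
/-- The number of Hecke indices at level `1` is `r + 1`. [cite: DiamondShurman2005, Prop. 5.2.1] -/
theorem card_heckeIdx_one : Fintype.card (HeckeIdx 1 r) = r + 1 := by
  rw [Fintype.card_congr (Equiv.subtypeUnivEquiv (fun o ↦ heckeIdx_one_cond hr o)), Fintype.card_option,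
    ZMod.card]

/-- **`T_r = ρ_r + r ρ_r⁻¹` on `Γ₀(M)`-invariant functions of cusps** (`r` prime, `r ∤ M`): for every `Γ₀(M)`-invariant
`w : P¹(ℚ) → K` and every cusp `x`, `(T_r w)(x) = Σᵢ w(βᵢ x) = w(ρ_r x) + r · w(ρ_r⁻¹ x)`.  Of the `r + 1` neighbours
`βᵢ x = g'ᵢ ∞`, the one with `σ(i) = ∞` is `ρ_r x`, and the `r` others lie in the `Γ₀(M)`-class of `ρ_r⁻¹ x`
(bottom rows in the class of `(r c, d)`), where `w` is constant.  MEMO-es §22.3: «`T_r = σ_r + r σ_r⁻¹` on `K̄[cusps]`».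
[cite: Shimura1971, §8.3 (8.3.2)] -/
theorem cuspFunHecke_eq_heckeNbr (hM : ¬ r ∣ M) {K : Type*} [CommRing K] (w : OnePoint ℚ → K)
    (hw : ∀ γ : Gamma0 M, ∀ x, w ((mapGL ℚ (γ : SL(2, ℤ)) : GL (Fin 2) ℚ) • x) = w x) (x : OnePoint ℚ) :
    cuspFunHecke M r K w x = w (heckeNbrInfty hr x) + (r : K) * w (heckeNbrZero hr x) := by
  obtain ⟨s, t, hst⟩ := exists_unit_of_prime_not_dvd hr hM
  set h : Gamma0 1 := cuspMatrix₁ x with hh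
  have hx : (mapGL ℚ (h : SL(2, ℤ)) : GL (Fin 2) ℚ) • (OnePoint.infty : OnePoint ℚ) = x := by
    rw [hh, coe_cuspMatrix₁, cuspMatrix_smul_infty]
  rw [cuspFunHecke_apply]
  -- reindex the level-`M` indices by the level-`1` indices (both are all of `Option (ZMod r)` since `r ∤ M`)
  let e : HeckeIdx M r ≃ HeckeIdx 1 r :=
    Equiv.subtypeEquivRight (fun o ↦ ⟨fun _ ↦ heckeIdx_one_cond hr o, fun _ _ ↦ hM⟩)
  rw [Fintype.sum_equiv e (fun i ↦ w (heckeRepGL r i.1 • x))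
    (fun i ↦ w (heckeRepGL r i.1 • x)) (fun i ↦ rfl)]
  -- each neighbour is `g'ᵢ ∞`
  have hterm : ∀ i : HeckeIdx 1 r, w (heckeRepGL r i.1 • x) =
      w ((mapGL ℚ ((heckePermElt hr h i : Gamma0 1) : SL(2, ℤ)) : GL (Fin 2) ℚ) • OnePoint.infty) := by
    intro i
    rw [← hx, heckeRepGL_smul_mapGL_smul_infty hr]
  rw [Fintype.sum_congr _ _ hterm, Fintype.sum_eq_add_sum_compl (heckeIdxPre hr h none)]
  -- the `r` indices with `σ(i) ≠ ∞` all give the value `w(ρ_r⁻¹ x)`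
  have hQ := cuspRel_heckePermElt_of_some hr h (heckeIdxPre hr h (some 0)) hst 0 (heckePerm_heckeIdxPre hr h (some 0))
  have hrest : ∀ i ∈ ({heckeIdxPre hr h none}ᶜ : Finset (HeckeIdx 1 r)),
      w ((mapGL ℚ ((heckePermElt hr h i : Gamma0 1) : SL(2, ℤ)) : GL (Fin 2) ℚ) • OnePoint.infty) =
        w (heckeNbrZero hr x) := by
    intro i hi
    rw [Finset.mem_compl, Finset.mem_singleton] at hi
    have hσ : (heckePerm hr h i).1 ≠ none := by
      intro hnone
      exact hi ((heckePerm_eq_none_iff hr h i).mp hnone)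
    obtain ⟨j', hj'⟩ := Option.ne_none_iff_exists'.mp hσ
    have hi' := cuspRel_heckePermElt_of_some hr h i hst j' hj'
    -- `bottom Q ~ (r c, d) ~ bottom g'ᵢ`
    have hQi := cuspRel_trans (M : ℤ) (primitive_mul_left (M : ℤ) (det_entries (h : SL(2, ℤ))) hst)
      (cuspRel_symm (M : ℤ) hQ) hi'
    rw [heckeNbrZero_def]
    exact (cuspFun_eq_of_cuspRel M w hw _ _ hQi).symm
  rw [Finset.sum_congr rfl hrest, Finset.sum_const, Finset.card_compl, card_heckeIdx_one hr,
    Finset.card_singleton, Nat.add_sub_cancel, nsmul_eq_mul, heckeNbrInfty_def]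

end HeckeSum

end Summit.BirchSwinnertonDyer.BirchSwinnertonDyer.Theorems.ManinLocalTwoThree
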